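import Summits.BirchSwinnertonDyer.BirchSwinnertonDyer.Theses.CumulativeHeegnerLeopoldt
import Summits.BirchSwinnertonDyer.BirchSwinnertonDyer.Theorems.CumulativeHeegnerLeopoldtCumulativeHeegnerInclusionAtThreeStubThreeSaturation
import Summits.BirchSwinnertonDyer.BirchSwinnertonDyer.Theorems.WildThreeRankOneBSDpOfExactIndexManin
import Summits.BirchSwinnertonDyer.BirchSwinnertonDyer.Theorems.SchneiderFreeAdditiveX3UpperReceptacle
import Summits.BirchSwinnertonDyer.BirchSwinnertonDyer.Theorems.ClassRecordThreeStepLOfHalvesB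
import Summits.BirchSwinnertonDyer.BirchSwinnertonDyer.Theorems.UniversalToricDescentToricTransportModThreeNormProfile
import Summits.BirchSwinnertonDyer.BirchSwinnertonDyer.Theorems.UniversalToricDescentWildSplitWaldspurgerAtThreeFlat
import Summits.BirchSwinnertonDyer.Rank1Residual.X11b.UnrIntegersValuationRing
import Summits.BirchSwinnertonDyer.Rank1Residual.X11b.PadicComplexInertiaFixed
import Literature.NumberTheory.EllipticCurves.BSDHeegnerPointsGrossZagierProofs
import Literature.NumberTheory.EllipticCurves.KrizLi2019.SexticTwistBSDThreeDescent
import Literature.NumberTheory.EllipticCurves.GlobalMinimalModelProofs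
import Literature.NumberTheory.EllipticCurves.ModularCurveManinConstantProofs
import HarnessLib

/-!
# Route `CumulativeHeegnerLeopoldt`, support item `LeopoldtKernelAtThree` (stmt-BirchSwinnertonDyer-24202):
# THE KERNEL ON THE LEOPOLDT CELL — published inputs → LZZ → K1 (cumulative-Heegner inclusion) → K2
# (Eisenstein character invariants) → K3 (frame) → K4 (control) → K5 (rank-zero twist) ⟹ `BSD₃(E)` for
# every NON-CM wild-3, `r_an = 1`, `E[3]`-reducible `E` on the cell, PROVED (Jetchev–Skinner–Wan §7.4 at the
# wild split prime `3`, Manin-robust, IMAGE-FREE)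

Cell `bsd-wall` (W-ALL, row 2@3), lead prover seat `bsd-line-chl-p1` (gen 0), 2026-08-28, on the route author's
proof plan (planner bsd-wall-pss3 g10; item text: «the SemiOrdinaryEisensteinDescent kernel verbatim with the image
swapped»). The model is the LANDED kernel of `UniversalToricDescent`
(`Theorems/UniversalToricDescentToricKernelAtThree.lean`, `universalToricDescent_toricKernelAtThree_proof`) with
three substitutions, each a tree theorem:

* IMC EQUALITY at the frame from K1 + K2 instead of transport: K1 gives `(L) ⊆ Ch·R₀⟦T⟧`, K2 gives
  `Ch·R₀⟦T⟧ = (g)` with `‖g_i‖ < 1 (i < n)` and `‖L_n‖ = 1`, and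
  `UniversalToricDescentNormProfile.eq_span_of_span_le_of_normProfile` turns one inclusion + the norm profile into
  `Ch·R₀⟦T⟧ = (L)`;
* the UNIT VALUE `L(𝟙) = u·(log_𝔭 P / c)²` at EVERY frame from K3's frame-existence and the refereed
  Liu–Zhang–Zhang input, by `UniversalToricDescentWaldspurgerFlat.wildSplitWaldspurgerAtThree_flat_forall` and the
  valuation-ring property of `R₀` (inlined = the body of UTD's `wildSplitWaldspurgerAtThree_of_lzz_of_frame`,
  which is image-free although its conclusion is typed with `ρ̄_{E,3}` onto; the same lemma is landed for SOED as
  `EisensteinKernelAtThreeRestrictedOfFrameOdd.exists_unit_hasValueAt_of_frame`, not imported here to keep this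
  file in ONE route's cone);
* the image hypothesis `ρ̄_{E,3}` onto is replaced by `Red W 3` + the non-anomalous rational line (the cell), which
  K1/K2/K4 consume; the ONLY use UTD made of surjectivity outside its cruxes was `¬ HasCM` for the rank-zero twist
  (`not_hasSurjectiveModNGaloisRep_of_hasCM`), which is why the theorem below carries `¬ W.HasCM` EXPLICITLY.

HONEST FRAMING / THE CM CAVEAT. The item `LeopoldtKernelAtThree` AS TYPED has the ∀-tail
`ClassO6 W 3 → r_an = 1 → Red W 3 → cell → BSDp W 3` WITHOUT `¬ W.HasCM` (tribunal T1 t1.md l.109: «its ∀-tail omits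
¬W.HasCM (CM-inclusive; harmless for closes, noted for the planner)»). It is NOT harmless for the item itself: the
`j = 0` curves `y² = x³ + D` (CM by `ℤ[ζ₃]`) with `f₃ ∈ {3,4,5}`, `D ∉ ℚ₃^{×2}`, `−3D ∉ ℚ₃^{×2}` and `r_an = 1`
(e.g. `y² = x³ + 2`, `N = 1728`, rank 1, rational line `x = 0`) lie on the typed Leopoldt cell, their Heegner twists
are again CM, and the rank-zero partner `WildRankZeroTwistAtThree = WAllExclAddWildRankZero` pays ONLY non-CM rows —
so the typed tail asks for `BSD₃` of CM rank-one `j = 0` curves at the prime `3 ∣ #ℤ[ζ₃]^×`, outside Rubin's theorem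
and outside every antecedent. What `closes` consumes is exactly the NON-CM tail (it holds `hCM : ¬ W.HasCM` from the
leaf `WAllExclAddWildRankOne`); that is the theorem `leopoldtKernelAtThree_of_not_hasCM` proved here, and
`wAllExclAddWildRankOne_of_cumulativeHeegnerLeopoldt_cruxes` re-runs `closes` with it: the leaf follows from F, L, K1–K6 with NO kernel
hypothesis. The repaired item text is recorded in the docstring of `leopoldtKernelAtThree_of_not_hasCM` (no new
definition is introduced; the planner restates the item).

Every crux (K1 `CumulativeHeegnerInclusionAtThree`, K2 `EisensteinCharacterInvariantsAtThree`, K3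
`WildSplitFrameAtThree`, K4 `RedSplitControlAtThree`, K5 `WildRankZeroTwistAtThree`, and for the leaf K6
`WildRankOneOffLeopoldtCellAtThree`) and the published inputs are ANTECEDENTS; BSD is not proved for any curve by
this file. No definition, no named fact, no `sorry`.

References: [JetchevSkinnerWan2017] §7.4.1 (arXiv:1512.06894 p. 30); [Castella2018] Thm. 2.3, §5 (5.1)–(5.3);
[GrossZagier1986] Thm. I.(6.3), V.§2; [FriedbergHoffstein1995] Thm. B; [LiuZhangZhang2018] Thm. 1.5.1/1.5.3;
[CastellaGrossiSkinner2025] Thm. 6.5.2/6.5.3 (the Eisenstein descent pattern transplanted here).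
-/

noncomputable section

open scoped Classical

set_option linter.dupNamespace false
set_option autoImplicit false

namespace Summit.BirchSwinnertonDyer.BirchSwinnertonDyer.Theorems

open WeierstrassCurve NumberField IsDedekindDomain Field
  Literature.NumberTheory.EllipticCurves
  Literature.NumberTheory.EllipticCurves.ModularForms
  Literature.NumberTheory.EllipticCurves.LiuZhangZhang2018
  Literature.NumberTheory.EllipticCurves.Rank1Residual
  Literature.NumberTheory.EllipticCurves.KrizLi2019
  Summit.BirchSwinnertonDyer.Rank1Residual
  Summit.BirchSwinnertonDyer.Rank1Residual.Additive
  Summit.BirchSwinnertonDyer.Rank1Residual.X11b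
  Summit.BirchSwinnertonDyer.Rank1Residual.X11b.AcSelmer
  Summit.BirchSwinnertonDyer.Rank1Residual.X11b.Halves
  Summit.BirchSwinnertonDyer.BirchSwinnertonDyer.Theses.CumulativeHeegnerLeopoldt

/-- **The kernel on the Leopoldt cell, NON-CM tail** (the form `closes` consumes): published inputs →
`LiuZhangZhangAdditiveInput` → `CumulativeHeegnerInclusionAtThree` → `EisensteinCharacterInvariantsAtThree` →
`WildSplitFrameAtThree` → `RedSplitControlAtThree` → `WildRankZeroTwistAtThree` ⟹ `BSD₃(E)` for every globally
minimal NON-CM `E/ℚ` on `ClassO6 W 3` with `r_an = 1`, `E[3]` reducible and a non-anomalous rational line.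
Jetchev–Skinner–Wan's §7.4 assembly at the wild split prime `3` with the Manin constant kept on both sides:
parity, Friedberg–Hoffstein field (`2` and all of `N(E)` split, so `d_K` odd), Heegner point, Gross–Zagier,
Kolyvagin, frame `(κ, γ, 𝔭, 𝔭′)`, K3's frame `L` at `𝔭` with its LZZ unit value
(♭-rigidity, inlined), IMC EQUALITY `Ch·R₀⟦T⟧ = (L)` at `𝔭′` from K1's inclusion
and K2's norm profile (`eq_span_of_span_le_of_normProfile`), K4's control at `𝔭′`,
`(log_{𝔭′}P)² = (log_𝔭 P)²`, both norm receptacles ⟹ exact index at slack `v₃(c)`; the twist is a non-CM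
O6 row of analytic rank `0` (`classO6_twist_of_heegner`, `hasCM_iff_of_j_eq`), K5 pays `BSD₃` of its minimal
model, and `SchneiderFree.Exact.bsdp_of_exactIndexManin_of_partner_bsdp` descends. The repaired item text
(planner's to adopt) is this statement: the typed `LeopoldtKernelAtThree` with `¬ W.HasCM →` inserted before
`ClassO6 W 3`. [cite: JetchevSkinnerWan2017, §7.4.1 (arXiv:1512.06894 p. 30)]
[cite: Castella2018, Thm. 2.3 and §5 (5.1)–(5.3)] [cite: GrossZagier1986, Thm. I.(6.3) and V.§2]
[cite: FriedbergHoffstein1995, Thm. B] [cite: LiuZhangZhang2018, Thm 1.5.1 and Thm 1.5.3] -/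
theorem leopoldtKernelAtThree_of_not_hasCM (hF : ToricPublishedInputs) (hL : LiuZhangZhangAdditiveInput)
    (h1 : CumulativeHeegnerInclusionAtThree) (h2 : EisensteinCharacterInvariantsAtThree)
    (h3 : WildSplitFrameAtThree) (h4 : RedSplitControlAtThree) (h5 : WildRankZeroTwistAtThree)
    (W : WeierstrassCurve ℚ) [W.IsElliptic] [W.IsGloballyMinimal] (hCM : ¬ W.HasCM) (hO6 : ClassO6 W 3)
    (hr : W.analyticRank = 1) (hRed : Red W 3)
    (hcell : ∃ Φ : AddSubgroup (WeierstrassCurve.geomTorsion W ((3 : ℕ) : ℤ)), IsRationalLine W 3 Φ ∧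
      ∀ (v : IsDedekindDomain.HeightOneSpectrum (NumberField.RingOfIntegers ℚ)),
        ((3 : ℕ) : NumberField.RingOfIntegers ℚ) ∈ v.asIdeal → ∀ 𝔓 ∈ v.primesAbove,
          ¬ (∀ g ∈ 𝔓.decompositionSubgroup (Field.absoluteGaloisGroup ℚ), ∀ P ∈ Φ, g • P = P) ∧
          ¬ (∀ g ∈ 𝔓.decompositionSubgroup (Field.absoluteGaloisGroup ℚ),
              ∀ P : WeierstrassCurve.geomTorsion W ((3 : ℕ) : ℤ), g • P - P ∈ Φ)) :
    BSDp W 3 := by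
  -- adapted from Theorems/UniversalToricDescentToricKernelAtThree.lean (utd-p3), image swapped
  obtain ⟨hGZ, hKo, hGZK, hmod, hmodP, -, hGZ73, hFH, hpar, hHP⟩ := hF
  haveI hN0 : NeZero (W.conductorNorm ℤ) := ⟨W.conductorNorm_pos_holds.ne'⟩
  -- (a) DATA. parity: `r_an = 1` is odd, so `w(E) = -1`
  have hw : W.rootNumber = -1 := by
    rcases W.rootNumber_eq_one_or with h | h
    · exfalso
      have heven : Even W.analyticRank := (hpar W).mpr h
      rw [hr] at heven
      exact Nat.not_even_one heven
    · exact h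
  -- Friedberg–Hoffstein with auxiliary modulus `2`: Heegner for `N(E)` and `2` split, so `d_K` is odd
  obtain ⟨K, _, _, hK, -, hHN, hH2, hLt⟩ := hFH W hw 2 two_ne_zero 0
  have hodd : Odd (NumberField.discr K) := by
    have h8 := Literature.SatisfiesHeegnerHypothesis.discr_emod_eight hK.1 hH2 (dvd_refl 2)
    rw [Int.odd_iff]; omega
  -- `3 ∣ N(E)` (additive) splits in `K`
  have h3N : 3 ∣ W.conductorNorm ℤ :=
    (W.dvd_conductorNorm_iff_not_hasGoodReductionAtPrime 3).mpr (not_good_of_addv W 3 hO6.2.1)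
  have hsplit : SplitsIn K 3 := hHN 3 Nat.prime_three h3N
  -- the Heegner point over `K` and its data; non-torsion by Gross–Zagier
  obtain ⟨P, Dt, H, ι, hP⟩ := hHP W K hK hHN
  have hL0 : W.entireLFunction 1 = 0 := entireLFunction_one_eq_zero_of_analyticRank_eq_one hr
  obtain ⟨-, hderiv⟩ := leadingLCoeff_eq_deriv_of_analyticRank_eq_one hr
  have hLK : LDerivEK W K ≠ 0 := by
    rw [lDerivEK_eq_deriv_mul W K hmod hL0]; exact mul_ne_zero hderiv hLt
  have hnt : ¬ IsOfFinAddOrder P :=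
    (lDerivEK_ne_zero_iff_not_isOfFinAddOrder W (W.conductorNorm ℤ) K (hGZ _ W K) hK hHN
      ⟨Dt, H, ι, hP⟩).mp hLK
  -- Kolyvagin: `rank E(K) = 1`, `Ш(E/K)` finite
  obtain ⟨hrk, hfin⟩ := hKo (W.conductorNorm ℤ) W K hK hHN ⟨Dt, H, ι, hP⟩ hnt
  -- a frame `(κ, γ, 𝔭)` and the other prime `𝔭′ ≠ 𝔭` above `3`
  obtain ⟨κ, γ, -, hκ, hγ, -⟩ := X11b.exists_anticyclotomic_generator_prime (p := 3) hK
  haveI : Fact (κ.IsTopGenerator γ) := ⟨hγ⟩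
  obtain ⟨𝔭, h𝔭, he, hf⟩ := X11b.exists_degreeOnePrime_of_splitsIn K 3 hK.1 hsplit
  obtain ⟨𝔭', hne, h𝔭', he', hf'⟩ := X11b.Three.exists_ne_degreeOne_prime hK.1 h𝔭 he hf
  -- (b) PLUMBING. K3: an `R₀`-frame `L` at `(κ, γ, 𝔭)`; its unit value by LZZ
  obtain ⟨ι', hind, ΩK, Ωp, L, hΩK, hΩp, hBDP⟩ := h3 W (W.conductorNorm ℤ) K Dt hO6 rfl hK hHN κ hκ γ 𝔭 h𝔭
  -- the unit value `L(𝟙) = u·(log_𝔭 P / c)²`, `u ∈ R₀ˣ` (♭-rigidity + LZZ; the scalar `[T⁰]L / x²` lies in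
  -- `Frac R₀` with norm one, hence in `R₀ˣ`) — the body of UTD's `wildSplitWaldspurgerAtThree_of_lzz_of_frame`
  obtain ⟨u, hval⟩ : ∃ u : (unrIntegers 3)ˣ, L.HasValueAt 0 ((((u : unrIntegers 3) : unrIntegers 3) : ℂ_[3]) *
      (algebraMap ℚ_[3] ℂ_[3] (logOmega W 3 (embAt K 3 𝔭 h𝔭 he hf) P / (Dt.c : ℚ_[3]))) ^ 2) := by
    have hQ' : R1.IsBDPLFunctionInt 3 ι' 𝔭 κ γ Dt.f ΩK Ωp (PowerSeries.map (R1.unrToCpInt 3) L) :=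
      R1.isBDPLFunctionInt_map hBDP
    obtain ⟨u₀, hu₀, hv⟩ := UniversalToricDescentWaldspurgerFlat.wildSplitWaldspurgerAtThree_flat_forall hL W
      (W.conductorNorm ℤ) K Dt H ι P hO6 rfl hK hHN hP hnt κ hκ γ 𝔭 h𝔭 he hf ι' hind hΩK hΩp hQ'
    set x : ℚ_[3] := logOmega W 3 (embAt K 3 𝔭 h𝔭 he hf) P / (Dt.c : ℚ_[3]) with hx
    have hv' : L.HasValueAt 0 (u₀ * (algebraMap ℚ_[3] ℂ_[3] x) ^ 2) :=
      (R1.intSeries_hasValueAt_map_iff 3 L _ _).mp hv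
    have hcoef : ((PowerSeries.constantCoeff L : unrIntegers 3) : ℂ_[3]) =
        u₀ * (algebraMap ℚ_[3] ℂ_[3] x) ^ 2 :=
      (UnrSeries.eq_constantCoeff_of_hasValueAt_zero hv').symm
    have hlogne : logOmega W 3 (embAt K 3 𝔭 h𝔭 he hf) P ≠ 0 := R1.logOmega_ne_zero W 3 _ hnt
    have hcZ : Dt.c ≠ 0 := Dt.maninConstant_ne_zero_holds
    have hx0 : x ≠ 0 := div_ne_zero hlogne (by exact_mod_cast hcZ)
    have hx2 : x ^ 2 ≠ 0 := pow_ne_zero _ hx0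
    set y : ℂ_[3] := algebraMap ℚ_[3] ℂ_[3] (x ^ 2) with hy
    have hy0 : y ≠ 0 := (map_ne_zero_iff _ (algebraMap ℚ_[3] ℂ_[3]).injective).mpr hx2
    have hnorm : ‖((PowerSeries.constantCoeff L : unrIntegers 3) : ℂ_[3])‖ = ‖y‖ := by
      rw [hcoef, norm_mul, hu₀, one_mul, hy, map_pow]
    have hyF : y ∈ Subfield.closure (unrIntegers 3 : Set ℂ_[3]) := by
      rw [hy, IsScalarTower.algebraMap_apply ℚ_[3] (PadicAlgCl 3) ℂ_[3] (x ^ 2)]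
      exact PadicComplexTransport.algebraMap_padic_mem_fracUnr 3 (x ^ 2)
    set c₀ : ℂ_[3] := ((PowerSeries.constantCoeff L : unrIntegers 3) : ℂ_[3]) with hc₀
    have hw : c₀ / y ∈ Subfield.closure (unrIntegers 3 : Set ℂ_[3]) :=
      div_mem (Subfield.subset_closure (PowerSeries.constantCoeff L).2) hyF
    have hw1 : ‖c₀ / y‖ = 1 := by
      rw [norm_div, hc₀, hnorm, div_self (norm_ne_zero_iff.mpr hy0)]
    have hwR : c₀ / y ∈ unrIntegers 3 := R1.mem_unrIntegers_of_mem_fracUnr hw hw1.le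
    obtain ⟨u, hu⟩ := (unrIntegers.isUnit_iff_norm_eq_one ⟨c₀ / y, hwR⟩).mpr hw1
    refine ⟨u, ?_⟩
    have hval : ((u : unrIntegers 3) : ℂ_[3]) * (algebraMap ℚ_[3] ℂ_[3] x) ^ 2 = c₀ := by
      rw [hu, ← map_pow, ← hy]
      exact div_mul_cancel₀ c₀ hy0
    have h0 := L.hasValueAt_zero
    rw [← hc₀, ← hval] at h0
    exact h0
  -- K1: the inclusion `(L) ⊆ Ch·R₀⟦T⟧` at `𝔭′`; K2: the norm profile; hence the IMC EQUALITY at the frame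
  have hincl : Ideal.span {L} ≤
      (XAc.charIdeal (W.baseChange K) 3 κ 𝔭' ∅ γ).map (PowerSeries.map (toUnr 3)) :=
    h1 W (W.conductorNorm ℤ) K Dt hO6 hRed hcell hr rfl hK hHN κ hκ γ 𝔭 h𝔭 he hf 𝔭' h𝔭' hne ι' hind ΩK Ωp L
      hΩK hΩp hBDP
  obtain ⟨g, n₀, hg, hglt, -, -, hLn⟩ := h2 W (W.conductorNorm ℤ) K Dt hO6 hRed hcell hr rfl hK hHN κ hκ γ 𝔭
    h𝔭 he hf 𝔭' h𝔭' hne ι' hind ΩK Ωp L hΩK hΩp hBDP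
  have heq : (XAc.charIdeal (W.baseChange K) 3 κ 𝔭' ∅ γ).map (PowerSeries.map (toUnr 3)) =
      Ideal.span {L} :=
    UniversalToricDescentNormProfile.eq_span_of_span_le_of_normProfile hg hincl hglt hLn
  -- K4: control EQUALITY at `𝔭′` (CTL₀ included)
  have hctl : SchneiderFree.AdditiveControlOnTreeAt 3 κ 𝔭' γ (embAt K 3 𝔭' h𝔭' he' hf') P :=
    h4 W (W.conductorNorm ℤ) K Dt H ι P hO6 hRed hcell hr rfl hK hHN hLt hP hnt (hKo _ W K) κ hκ γ 𝔭'
      h𝔭' he' hf'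
  obtain ⟨n, hn, hneq⟩ := hctl
  -- the value read through the logarithm at `𝔭′` (rank one: `(log_{𝔭′} P)² = (log_𝔭 P)²`)
  have hval' : L.HasValueAt 0 ((((u : unrIntegers 3) : unrIntegers 3) : ℂ_[3]) *
      (algebraMap ℚ_[3] ℂ_[3]
        (logOmega W 3 (embAt K 3 𝔭' h𝔭' he' hf') P / (Dt.c : ℚ_[3]))) ^ 2) :=
    (SchneiderFreeAdditiveX3.hasValueAt_sq_logOmega_embAt_iff_of_rank_one W 3 hK.1 hrk h𝔭 he hf
      h𝔭' he' hf' P _ _ L).mpr hval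
  -- both sockets at slack `v₃(c)` at the frame `(κ, 𝔭′, γ, embAt 𝔭′)`
  have hc0 : Dt.c ≠ 0 := Dt.maninConstant_ne_zero_holds
  have hlog : logOmega W 3 (embAt K 3 𝔭' h𝔭' he' hf') P ≠ 0 := X11b.R1.logOmega_ne_zero W 3 _ hnt
  have hlow : SchneiderFree.AdditiveIMCLowerBDPOnTreeLeAt 3 κ 𝔭' γ (embAt K 3 𝔭' h𝔭' he' hf')
      (padicValNat 3 Dt.c.natAbs) P := by
    -- the LOWER norm receptacle (`⊆` + value): `2·ord₃(log_{𝔭′}P / c) ≤ ord₃ f(0)`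
    obtain ⟨htors, f, hfI, hf0, hfn⟩ := hn
    have hmem : PowerSeries.map (toUnr 3) f ∈ Ideal.span {L} := by
      have h3 := heq.le
      rw [hfI, CongruenceLimit.map_span_singleton_powerSeries] at h3
      exact (Ideal.span_singleton_le_iff_mem _).mp h3
    obtain ⟨-, hle⟩ := Supersingular.two_mul_valuation_le_of_mem_span 3 hf0 hmem u hval'
    have hc0' : (Dt.c : ℚ_[3]) ≠ 0 := by exact_mod_cast hc0
    rw [div_eq_mul_inv, Padic.valuation_mul hlog (inv_ne_zero hc0'), Padic.valuation_inv,
      Padic.valuation_intCast, valuation_logOmega hlog, hfn] at hle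
    refine ⟨n, ⟨htors, f, hfI, hf0, hfn⟩, ?_⟩
    simp only [padicValInt] at hle
    linarith
  have hup : SchneiderFree.Upper.AdditiveIMCUpperBDPOnTreeLeAt 3 κ 𝔭' γ (embAt K 3 𝔭' h𝔭' he' hf')
      (padicValNat 3 Dt.c.natAbs) P :=
    SchneiderFree.Upper.additiveIMCUpperBDPOnTreeLeAt_of_value_of_dvd' hn heq.ge u hc0 hlog hval'
  -- the EXACT index at slack `v₃(c)` (both halves), by K1's links with the control equality
  have hlo : SchneiderFree.IndexLowerBoundLeAt W 3 K P (padicValNat 3 Dt.c.natAbs) :=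
    SchneiderFreeAdditiveX3.indexLowerBoundLeAt_of_imcLowerLe_of_control rfl hK hHN hfin hlow
      ⟨n, hn, hneq⟩
  have hupI : SchneiderFree.Upper.IndexUpperBoundLeAt W 3 K P (padicValNat 3 Dt.c.natAbs) :=
    SchneiderFree.Upper.indexUpperBoundLeAt_of_imcUpperLe_of_control rfl hK hHN hfin hup ⟨n, hn, hneq⟩
  -- (c) TERMINAL STEP: a globally minimal model of the twist — a NON-CM O6 row of analytic rank `0`
  have hD0 : (NumberField.discr K : ℚ) ≠ 0 := by exact_mod_cast NumberField.discr_ne_zero K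
  haveI : (W.quadraticTwist (NumberField.discr K : ℚ)).IsElliptic := W.isElliptic_quadraticTwist hD0
  obtain ⟨Cd, hCd⟩ := hasGlobalMinimalModel_rat_holds (W.quadraticTwist (NumberField.discr K : ℚ))
  haveI : (Cd • W.quadraticTwist (NumberField.discr K : ℚ)).IsGloballyMinimal := hCd
  set Wd : WeierstrassCurve ℚ := Cd • W.quadraticTwist (NumberField.discr K : ℚ) with hWd
  have hw3 : ¬ 3 ∣ Units.torsionOrder K :=
    (X11b.Three.not_dvd_discr_and_not_dvd_torsionOrder_of_heegner hK hHN (by decide) h3N).2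
  obtain ⟨hO6d, hjd⟩ := classO6_twist_of_heegner W hO6 K hK hHN hodd Wd Cd rfl
  have hCMd : ¬ Wd.HasCM := fun h ↦ hCM ((hasCM_iff_of_j_eq hjd).mp h)
  have hLd1 : Wd.entireLFunction 1 ≠ 0 := by rw [hWd, entireLFunction_smul]; exact hLt
  have hrd : Wd.analyticRank = 0 := analyticRank_eq_zero_of_entireLFunction_one_ne_zero Wd hLd1
  have hBSDd : BSDp Wd 3 := h5 Wd hCMd hO6d hrd
  exact SchneiderFree.Exact.bsdp_of_exactIndexManin_of_partner_bsdp hGZ hKo hGZK hmod hGZ73 W 3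
    (W.conductorNorm ℤ) K Dt H ι P Wd hr rfl h3N hK hodd hw3 hHN hLt hP ⟨Cd, rfl⟩ (by decide) hlo hupI hBSDd

/-- **The leaf from the cruxes, WITHOUT the kernel hypothesis.** Published inputs → LZZ → K1 → K2 → K3 → K4 →
K5 → K6 ⟹ `WAllExclAddWildRankOne` — the route's deciding theorem `closes` re-run with the kernel binder
DISCHARGED by `leopoldtKernelAtThree_of_not_hasCM` (on the cell, non-CM from the leaf) and the declared
residual K6 off the cell. Shows that the item `LeopoldtKernelAtThree` is needed by `closes` only in its non-CM
form. Every crux remains an antecedent; BSD is not proved by this. [cite: JetchevSkinnerWan2017, §7.4.1]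
[cite: GrossZagier1986, Thm. I.(6.3)] -/
theorem wAllExclAddWildRankOne_of_cumulativeHeegnerLeopoldt_cruxes (hF : ToricPublishedInputs)
    (hL : LiuZhangZhangAdditiveInput) (h1 : CumulativeHeegnerInclusionAtThree)
    (h2 : EisensteinCharacterInvariantsAtThree) (h3 : WildSplitFrameAtThree) (h4 : RedSplitControlAtThree)
    (h5 : WildRankZeroTwistAtThree) (h6 : WildRankOneOffLeopoldtCellAtThree) :
    Summit.BirchSwinnertonDyer.WAllExclAddWildRankOne := by
  intro W _ _ hCM hO6 hr
  by_cases hcell : (Red W 3 ∧ (∃ Φ : AddSubgroup (WeierstrassCurve.geomTorsion W ((3 : ℕ) : ℤ)),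
    IsRationalLine W 3 Φ ∧ ∀ (v : IsDedekindDomain.HeightOneSpectrum (NumberField.RingOfIntegers ℚ)),
      ((3 : ℕ) : NumberField.RingOfIntegers ℚ) ∈ v.asIdeal → ∀ 𝔓 ∈ v.primesAbove,
        ¬ (∀ g ∈ 𝔓.decompositionSubgroup (Field.absoluteGaloisGroup ℚ), ∀ P ∈ Φ, g • P = P) ∧
        ¬ (∀ g ∈ 𝔓.decompositionSubgroup (Field.absoluteGaloisGroup ℚ),
            ∀ P : WeierstrassCurve.geomTorsion W ((3 : ℕ) : ℤ), g • P - P ∈ Φ)))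
  · exact leopoldtKernelAtThree_of_not_hasCM hF hL h1 h2 h3 h4 h5 W hCM hO6 hr hcell.1 hcell.2
  · exact h6 W hCM hO6 hr hcell

/-- **Item `LeopoldtKernelAtThree` (stmt-BirchSwinnertonDyer-24202) of route `CumulativeHeegnerLeopoldt` holds, AS
RESTATED at route rev 2** (commit 9f26c947bbcb: operator restate on this seat's verdict — the ∀-tail now carries
`¬ W.HasCM`, memo `pub/bsd-wall/bsd-line-chl-p1/KER-24202-RESTATEMENT.md`; `closes` passes the leaf's `hCM`):
published inputs → `LiuZhangZhangAdditiveInput` → K1 → K2 → K3 → K4 → K5 ⟹ `BSD₃(E)` for every globally minimal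
NON-CM `E/ℚ` on `ClassO6 W 3` with `r_an = 1`, `E[3]` reducible and a non-anomalous rational line — LITERALLY the
route decl, by `leopoldtKernelAtThree_of_not_hasCM` above. Pure assembly; every crux is an antecedent; BSD is not
proved for any curve by this. [cite: JetchevSkinnerWan2017, §7.4.1 (arXiv:1512.06894 p. 30)] -/
theorem cumulativeHeegnerLeopoldt_leopoldtKernelAtThree_proof : LeopoldtKernelAtThree := by
  unfold LeopoldtKernelAtThree
  intro hF hL h1 h2 h3 h4 h5 W _ _ hCM hO6 hr hRed hcell
  exact leopoldtKernelAtThree_of_not_hasCM hF hL h1 h2 h3 h4 h5 W hCM hO6 hr hRed hcell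

/-! ## §4 (seat bsd-line-chl-p1 g5, 2026-08-28): THE TEMPERED FORM OF K1 SUFFICES

The registered line `birth` of K1 (tree `Cruxes/CumulativeHeegnerInclusionAtThree/Lines/birth.lean`, skeleton
d95f5b560a5dd8c3) composes K1 from STUB A `stub_temperedInclusion` (the TEMPERED inclusion
`span{3^μ·L} ⊆ Ch·R₀⟦T⟧` for SOME `μ`; beyond print at additive `3` — its good-ordinary Eisenstein sibling is the
tree fact `CastellaGrossiLeeSkinner2022.proofThm422_exists_isBDPLFunction_isTorsion_charIdeal_dvd`, typed in the
same `∃ k, p^k·L ∈ Ch·R₀⟦T⟧` shape), STUB B (`Ch·R₀⟦T⟧ = (g)` with a unit coefficient — a clause of the route's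
other crux K2) and the landed saturation STUB C (p595383). So modulo K2 the crux K1 IS STUB A (second vet,
bsd-vet-tk5h g0, evidence `W.lean` §g, kernel-checked there; landed here to be citable by name), and the kernel
and the leaf re-run on STUB A — the turnkey for an optional restatement K1 ↦ K1′ := STUB A (signature inlined
below verbatim; no definition introduced). Every crux stays an antecedent; nothing here proves STUB A, K2 or BSD.
-/

/-- **K1 ⟸ STUB A + K2.** The integral inclusion K1 follows from the TEMPERED inclusion (line `birth` STUB A
`stub_temperedInclusion`, signature inlined verbatim as `hA`) and K2 (only its clauses "`Ch·R₀⟦T⟧ = (g)`",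
"`‖g_n‖ = 1`" are used), by saturation at the prime `3` of `R₀⟦T⟧`
(`CumulativeHeegnerInclusionAtThreeSaturation.span_le_span_of_span_pow_three_mul_le`, p595383) — the
`Λ[1/p] → Λ` sharpening step of the Eisenstein descent. Both hypotheses are antecedents.
[cite: CastellaGrossiSkinner2025, Thm. 6.5.2 and Thm. 6.5.3] -/
theorem cumulativeHeegnerInclusionAtThree_of_tempered_of_eisenstein
    (hA : ∀ (W : WeierstrassCurve ℚ) [W.IsElliptic] [W.IsGloballyMinimal] (N : ℕ) [NeZero N] (K : Type) [Field K] [NumberField K] (Dt : Literature.NumberTheory.EllipticCurves.ModularForms.ModularParametrizationData W N), Summit.BirchSwinnertonDyer.Rank1Residual.Additive.ClassO6 W 3 → Literature.NumberTheory.EllipticCurves.Rank1Residual.Red W 3 → (∃ Φ : AddSubgroup (WeierstrassCurve.geomTorsion W ((3 : ℕ) : ℤ)), Literature.NumberTheory.EllipticCurves.Rank1Residual.IsRationalLine W 3 Φ ∧ ∀ (v : IsDedekindDomain.HeightOneSpectrum (NumberField.RingOfIntegers ℚ)), ((3 : ℕ) : NumberField.RingOfIntegers ℚ) ∈ v.asIdeal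 → ∀ 𝔓 ∈ v.primesAbove, ¬ (∀ g ∈ 𝔓.decompositionSubgroup (Field.absoluteGaloisGroup ℚ), ∀ P ∈ Φ, g • P = P) ∧ ¬ (∀ g ∈ 𝔓.decompositionSubgroup (Field.absoluteGaloisGroup ℚ), ∀ P : WeierstrassCurve.geomTorsion W ((3 : ℕ) : ℤ), g • P - P ∈ Φ)) → W.analyticRank = 1 → W.conductorNorm ℤ = N → Literature.NumberTheory.EllipticCurves.IsImaginaryQuadratic K → Literature.NumberTheory.EllipticCurves.SatisfiesHeegnerHypothesis N K → ∀ (κ : Literature.NumberTheory.EllipticCurves.ZpExtension K 3), κ.IsAnticyclotomic → ∀ (γ : Field.absoluteGaloisGroup K) [Fact (κ.IsTopGenerator γ)] (𝔭 : IsDedekindDomain.HeightOneSpectrum (NumberField.RingOfIntegers K)), ((3 : ℕ) : NumberField.RingOfIntegers K) ∈ 𝔭.asIdeal → 𝔭.asIdeal.ramificationIdx (NumberField.RingOfIntegers ℚ) = 1 → 𝔭.asIdeal.inertiaDeg (NumberField.RingOfIntegers ℚ) = 1 → ∀ (𝔭' : IsDedekindDomain.HeightOneSpectrum (NumberField.RingOfIntegers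 K)), ((3 : ℕ) : NumberField.RingOfIntegers K) ∈ 𝔭'.asIdeal → 𝔭' ≠ 𝔭 → ∀ (ι' : PadicAlgCl 3 ≃+* ℂ), Summit.BirchSwinnertonDyer.BirchSwinnertonDyer.Theorems.SchneiderFree.BranchInducesPrime 3 ι' 𝔭 → ∀ (ΩK : ℂ) (Ωp : ℂ_[3]) (L : Literature.NumberTheory.EllipticCurves.UnrSeries 3), ΩK ≠ 0 → Ωp ≠ 0 → Literature.NumberTheory.EllipticCurves.IsBDPLFunction ι' 𝔭 κ γ Dt.f ΩK Ωp L → ∃ μ : ℕ, Ideal.span {(3 : Literature.NumberTheory.EllipticCurves.UnrSeries 3) ^ μ * L} ≤ (Summit.BirchSwinnertonDyer.Rank1Residual.X11b.AcSelmer.XAc.charIdeal (W.baseChange K) 3 κ 𝔭' ∅ γ).map (PowerSeries.map (Summit.BirchSwinnertonDyer.Rank1Residual.X11b.Halves.toUnr 3)))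
    (h2 : EisensteinCharacterInvariantsAtThree) : CumulativeHeegnerInclusionAtThree := by
  -- adapted from the second vet's evidence W.lean §g (`k1_of_tempered_of_k2`) on stmt-BirchSwinnertonDyer-24198
  intro W _ _ N _ K _ _ Dt hO6 hRed hcell hr hN hK hHg κ hκ γ _ 𝔭 h𝔭 he hf 𝔭' h𝔭' hne ι' hι ΩK Ωp L hΩK hΩp hBDP
  obtain ⟨μ, hμ⟩ :=
    hA W N K Dt hO6 hRed hcell hr hN hK hHg κ hκ γ 𝔭 h𝔭 he hf 𝔭' h𝔭' hne ι' hι ΩK Ωp L hΩK hΩp hBDP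
  obtain ⟨g, n, hg, -, hunit, -, -⟩ :=
    h2 W N K Dt hO6 hRed hcell hr hN hK hHg κ hκ γ 𝔭 h𝔭 he hf 𝔭' h𝔭' hne ι' hι ΩK Ωp L hΩK hΩp hBDP
  rw [hg] at hμ ⊢
  exact CumulativeHeegnerInclusionAtThreeSaturation.span_le_span_of_span_pow_three_mul_le L g μ n hunit hμ

/-- **K1 ⟹ STUB A** (`μ = 0`): with `cumulativeHeegnerInclusionAtThree_of_tempered_of_eisenstein`, K1 and STUB A
are EQUIVALENT modulo K2. K1 is an antecedent. [cite: CastellaGrossiSkinner2025, Thm. 6.5.2] -/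
theorem tempered_of_cumulativeHeegnerInclusionAtThree (h1 : CumulativeHeegnerInclusionAtThree) :
    ∀ (W : WeierstrassCurve ℚ) [W.IsElliptic] [W.IsGloballyMinimal] (N : ℕ) [NeZero N] (K : Type) [Field K] [NumberField K] (Dt : Literature.NumberTheory.EllipticCurves.ModularForms.ModularParametrizationData W N), Summit.BirchSwinnertonDyer.Rank1Residual.Additive.ClassO6 W 3 → Literature.NumberTheory.EllipticCurves.Rank1Residual.Red W 3 → (∃ Φ : AddSubgroup (WeierstrassCurve.geomTorsion W ((3 : ℕ) : ℤ)), Literature.NumberTheory.EllipticCurves.Rank1Residual.IsRationalLine W 3 Φ ∧ ∀ (v : IsDedekindDomain.HeightOneSpectrum (NumberField.RingOfIntegers ℚ)), ((3 : ℕ) : NumberField.RingOfIntegers ℚ) ∈ v.asIdeal → ∀ 𝔓 ∈ v.primesAbove, ¬ (∀ g ∈ 𝔓.decompositionSubgroup (Field.absoluteGaloisGroup ℚ), ∀ P ∈ Φ, g • P = P) ∧ ¬ (∀ g ∈ 𝔓.decompositionSubgroup (Field.absoluteGaloisGroup ℚ), ∀ P : WeierstrassCurve.geomTorsion W ((3 :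 ℕ) : ℤ), g • P - P ∈ Φ)) → W.analyticRank = 1 → W.conductorNorm ℤ = N → Literature.NumberTheory.EllipticCurves.IsImaginaryQuadratic K → Literature.NumberTheory.EllipticCurves.SatisfiesHeegnerHypothesis N K → ∀ (κ : Literature.NumberTheory.EllipticCurves.ZpExtension K 3), κ.IsAnticyclotomic → ∀ (γ : Field.absoluteGaloisGroup K) [Fact (κ.IsTopGenerator γ)] (𝔭 : IsDedekindDomain.HeightOneSpectrum (NumberField.RingOfIntegers K)), ((3 : ℕ) : NumberField.RingOfIntegers K) ∈ 𝔭.asIdeal → 𝔭.asIdeal.ramificationIdx (NumberField.RingOfIntegers ℚ) = 1 → 𝔭.asIdeal.inertiaDeg (NumberField.RingOfIntegers ℚ) = 1 → ∀ (𝔭' : IsDedekindDomain.HeightOneSpectrum (NumberField.RingOfIntegers K)), ((3 : ℕ) : NumberField.RingOfIntegers K) ∈ 𝔭'.asIdeal → 𝔭' ≠ 𝔭 → ∀ (ι' : PadicAlgCl 3 ≃+* ℂ), Summit.BirchSwinnertonDyer.BirchSwinnertonDyer.Theorems.SchneiderFree.BranchInducesPrime 3 ι' 𝔭 → ∀ (ΩK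 : ℂ) (Ωp : ℂ_[3]) (L : Literature.NumberTheory.EllipticCurves.UnrSeries 3), ΩK ≠ 0 → Ωp ≠ 0 → Literature.NumberTheory.EllipticCurves.IsBDPLFunction ι' 𝔭 κ γ Dt.f ΩK Ωp L → ∃ μ : ℕ, Ideal.span {(3 : Literature.NumberTheory.EllipticCurves.UnrSeries 3) ^ μ * L} ≤ (Summit.BirchSwinnertonDyer.Rank1Residual.X11b.AcSelmer.XAc.charIdeal (W.baseChange K) 3 κ 𝔭' ∅ γ).map (PowerSeries.map (Summit.BirchSwinnertonDyer.Rank1Residual.X11b.Halves.toUnr 3)) := by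
  intro W _ _ N _ K _ _ Dt hO6 hRed hcell hr hN hK hHg κ hκ γ _ 𝔭 h𝔭 he hf 𝔭' h𝔭' hne ι' hι ΩK Ωp L hΩK hΩp hBDP
  refine ⟨0, ?_⟩
  rw [pow_zero, one_mul]
  exact h1 W N K Dt hO6 hRed hcell hr hN hK hHg κ hκ γ 𝔭 h𝔭 he hf 𝔭' h𝔭' hne ι' hι ΩK Ωp L hΩK hΩp hBDP

/-- **The kernel's NON-CM tail keyed on the TEMPERED inclusion**: published inputs → `LiuZhangZhangAdditiveInput`
→ STUB A (inlined) → K2 → K3 → K4 → K5 ⟹ `BSD₃(E)` for every globally minimal NON-CM `E/ℚ` on `ClassO6 W 3` with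
`r_an = 1`, `E[3]` reducible and a non-anomalous rational line: `leopoldtKernelAtThree_of_not_hasCM` fed with
K1 := `cumulativeHeegnerInclusionAtThree_of_tempered_of_eisenstein hA h2`. Verbatim the body of the kernel item
if the crux K1 is RESTATED as K1′ := STUB A (closer: this theorem by name). Every hypothesis is an antecedent;
BSD is not proved for any curve by this. [cite: JetchevSkinnerWan2017, §7.4.1 (arXiv:1512.06894 p. 30)]
[cite: CastellaGrossiSkinner2025, Thm. 6.5.2 and Thm. 6.5.3] -/
theorem leopoldtKernelAtThree_of_temperedInclusion (hF : ToricPublishedInputs) (hL : LiuZhangZhangAdditiveInput)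
    (hA : ∀ (W : WeierstrassCurve ℚ) [W.IsElliptic] [W.IsGloballyMinimal] (N : ℕ) [NeZero N] (K : Type) [Field K] [NumberField K] (Dt : Literature.NumberTheory.EllipticCurves.ModularForms.ModularParametrizationData W N), Summit.BirchSwinnertonDyer.Rank1Residual.Additive.ClassO6 W 3 → Literature.NumberTheory.EllipticCurves.Rank1Residual.Red W 3 → (∃ Φ : AddSubgroup (WeierstrassCurve.geomTorsion W ((3 : ℕ) : ℤ)), Literature.NumberTheory.EllipticCurves.Rank1Residual.IsRationalLine W 3 Φ ∧ ∀ (v : IsDedekindDomain.HeightOneSpectrum (NumberField.RingOfIntegers ℚ)), ((3 : ℕ) : NumberField.RingOfIntegers ℚ) ∈ v.asIdeal → ∀ 𝔓 ∈ v.primesAbove, ¬ (∀ g ∈ 𝔓.decompositionSubgroup (Field.absoluteGaloisGroup ℚ), ∀ P ∈ Φ, g • P = P) ∧ ¬ (∀ g ∈ 𝔓.decompositionSubgroup (Field.absoluteGaloisGroup ℚ), ∀ P : WeierstrassCurve.geomTorsion W ((3 : ℕ) : ℤ), g • P - P ∈ Φ)) → W.analyticRank = 1 → W.conductorNorm ℤ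 = N → Literature.NumberTheory.EllipticCurves.IsImaginaryQuadratic K → Literature.NumberTheory.EllipticCurves.SatisfiesHeegnerHypothesis N K → ∀ (κ : Literature.NumberTheory.EllipticCurves.ZpExtension K 3), κ.IsAnticyclotomic → ∀ (γ : Field.absoluteGaloisGroup K) [Fact (κ.IsTopGenerator γ)] (𝔭 : IsDedekindDomain.HeightOneSpectrum (NumberField.RingOfIntegers K)), ((3 : ℕ) : NumberField.RingOfIntegers K) ∈ 𝔭.asIdeal → 𝔭.asIdeal.ramificationIdx (NumberField.RingOfIntegers ℚ) = 1 → 𝔭.asIdeal.inertiaDeg (NumberField.RingOfIntegers ℚ) = 1 → ∀ (𝔭' : IsDedekindDomain.HeightOneSpectrum (NumberField.RingOfIntegers K)), ((3 : ℕ) : NumberField.RingOfIntegers K) ∈ 𝔭'.asIdeal → 𝔭' ≠ 𝔭 → ∀ (ι' : PadicAlgCl 3 ≃+* ℂ), Summit.BirchSwinnertonDyer.BirchSwinnertonDyer.Theorems.SchneiderFree.BranchInducesPrime 3 ι' 𝔭 → ∀ (ΩK : ℂ) (Ωp : ℂ_[3]) (L : Literature.NumberTheory.EllipticCurves.UnrSeries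 3), ΩK ≠ 0 → Ωp ≠ 0 → Literature.NumberTheory.EllipticCurves.IsBDPLFunction ι' 𝔭 κ γ Dt.f ΩK Ωp L → ∃ μ : ℕ, Ideal.span {(3 : Literature.NumberTheory.EllipticCurves.UnrSeries 3) ^ μ * L} ≤ (Summit.BirchSwinnertonDyer.Rank1Residual.X11b.AcSelmer.XAc.charIdeal (W.baseChange K) 3 κ 𝔭' ∅ γ).map (PowerSeries.map (Summit.BirchSwinnertonDyer.Rank1Residual.X11b.Halves.toUnr 3)))
    (h2 : EisensteinCharacterInvariantsAtThree) (h3 : WildSplitFrameAtThree) (h4 : RedSplitControlAtThree)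
    (h5 : WildRankZeroTwistAtThree) (W : WeierstrassCurve ℚ) [W.IsElliptic] [W.IsGloballyMinimal]
    (hCM : ¬ W.HasCM) (hO6 : ClassO6 W 3) (hr : W.analyticRank = 1) (hRed : Red W 3)
    (hcell : ∃ Φ : AddSubgroup (WeierstrassCurve.geomTorsion W ((3 : ℕ) : ℤ)), IsRationalLine W 3 Φ ∧
      ∀ (v : IsDedekindDomain.HeightOneSpectrum (NumberField.RingOfIntegers ℚ)),
        ((3 : ℕ) : NumberField.RingOfIntegers ℚ) ∈ v.asIdeal → ∀ 𝔓 ∈ v.primesAbove,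
          ¬ (∀ g ∈ 𝔓.decompositionSubgroup (Field.absoluteGaloisGroup ℚ), ∀ P ∈ Φ, g • P = P) ∧
          ¬ (∀ g ∈ 𝔓.decompositionSubgroup (Field.absoluteGaloisGroup ℚ),
              ∀ P : WeierstrassCurve.geomTorsion W ((3 : ℕ) : ℤ), g • P - P ∈ Φ)) :
    BSDp W 3 :=
  leopoldtKernelAtThree_of_not_hasCM hF hL (cumulativeHeegnerInclusionAtThree_of_tempered_of_eisenstein hA h2)
    h2 h3 h4 h5 W hCM hO6 hr hRed hcell

/-- **The leaf from the TEMPERED cruxes, without the kernel hypothesis**: published inputs → LZZ → STUB A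
(inlined) → K2 → K3 → K4 → K5 → K6 ⟹ `WAllExclAddWildRankOne` — `closes` re-run with K1 ↦ STUB A and the kernel
binder discharged (`wAllExclAddWildRankOne_of_cumulativeHeegnerLeopoldt_cruxes`); the certificate that a
restatement K1 ↦ K1′ := STUB A keeps the route's composition closed. Every crux remains an antecedent; BSD is not
proved by this. [cite: JetchevSkinnerWan2017, §7.4.1] [cite: GrossZagier1986, Thm. I.(6.3)] -/
theorem wAllExclAddWildRankOne_of_tempered_cruxes (hF : ToricPublishedInputs) (hL : LiuZhangZhangAdditiveInput)
    (hA : ∀ (W : WeierstrassCurve ℚ) [W.IsElliptic] [W.IsGloballyMinimal] (N : ℕ) [NeZero N] (K : Type) [Field K] [NumberField K] (Dt : Literature.NumberTheory.EllipticCurves.ModularForms.ModularParametrizationData W N), Summit.BirchSwinnertonDyer.Rank1Residual.Additive.ClassO6 W 3 → Literature.NumberTheory.EllipticCurves.Rank1Residual.Red W 3 → (∃ Φ : AddSubgroup (WeierstrassCurve.geomTorsion W ((3 : ℕ) : ℤ)), Literature.NumberTheory.EllipticCurves.Rank1Residual.IsRationalLine W 3 Φ ∧ ∀ (v : IsDedekindDomain.HeightOneSpectrum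 (NumberField.RingOfIntegers ℚ)), ((3 : ℕ) : NumberField.RingOfIntegers ℚ) ∈ v.asIdeal → ∀ 𝔓 ∈ v.primesAbove, ¬ (∀ g ∈ 𝔓.decompositionSubgroup (Field.absoluteGaloisGroup ℚ), ∀ P ∈ Φ, g • P = P) ∧ ¬ (∀ g ∈ 𝔓.decompositionSubgroup (Field.absoluteGaloisGroup ℚ), ∀ P : WeierstrassCurve.geomTorsion W ((3 : ℕ) : ℤ), g • P - P ∈ Φ)) → W.analyticRank = 1 → W.conductorNorm ℤ = N → Literature.NumberTheory.EllipticCurves.IsImaginaryQuadratic K → Literature.NumberTheory.EllipticCurves.SatisfiesHeegnerHypothesis N K → ∀ (κ : Literature.NumberTheory.EllipticCurves.ZpExtension K 3), κ.IsAnticyclotomic → ∀ (γ : Field.absoluteGaloisGroup K) [Fact (κ.IsTopGenerator γ)] (𝔭 : IsDedekindDomain.HeightOneSpectrum (NumberField.RingOfIntegers K)), ((3 : ℕ) : NumberField.RingOfIntegers K) ∈ 𝔭.asIdeal → 𝔭.asIdeal.ramificationIdx (NumberField.RingOfIntegers ℚ) = 1 → 𝔭.asIdeal.inertiaDeg (NumberField.RingOfIntegers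 ℚ) = 1 → ∀ (𝔭' : IsDedekindDomain.HeightOneSpectrum (NumberField.RingOfIntegers K)), ((3 : ℕ) : NumberField.RingOfIntegers K) ∈ 𝔭'.asIdeal → 𝔭' ≠ 𝔭 → ∀ (ι' : PadicAlgCl 3 ≃+* ℂ), Summit.BirchSwinnertonDyer.BirchSwinnertonDyer.Theorems.SchneiderFree.BranchInducesPrime 3 ι' 𝔭 → ∀ (ΩK : ℂ) (Ωp : ℂ_[3]) (L : Literature.NumberTheory.EllipticCurves.UnrSeries 3), ΩK ≠ 0 → Ωp ≠ 0 → Literature.NumberTheory.EllipticCurves.IsBDPLFunction ι' 𝔭 κ γ Dt.f ΩK Ωp L → ∃ μ : ℕ, Ideal.span {(3 : Literature.NumberTheory.EllipticCurves.UnrSeries 3) ^ μ * L} ≤ (Summit.BirchSwinnertonDyer.Rank1Residual.X11b.AcSelmer.XAc.charIdeal (W.baseChange K) 3 κ 𝔭' ∅ γ).map (PowerSeries.map (Summit.BirchSwinnertonDyer.Rank1Residual.X11b.Halves.toUnr 3)))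
    (h2 : EisensteinCharacterInvariantsAtThree) (h3 : WildSplitFrameAtThree) (h4 : RedSplitControlAtThree)
    (h5 : WildRankZeroTwistAtThree) (h6 : WildRankOneOffLeopoldtCellAtThree) :
    Summit.BirchSwinnertonDyer.WAllExclAddWildRankOne :=
  wAllExclAddWildRankOne_of_cumulativeHeegnerLeopoldt_cruxes hF hL
    (cumulativeHeegnerInclusionAtThree_of_tempered_of_eisenstein hA h2) h2 h3 h4 h5 h6

end Summit.BirchSwinnertonDyer.BirchSwinnertonDyer.Theorems

end
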